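import Mathlib
import HarnessLib
import Summits.QuantumFields.YangMills.Theses.FradkinShenkerFlow
import Summits.QuantumFields.YangMills.Theses.EquipartitionCriticality
import Summits.QuantumFields.YangMills.Theses.DirichletWindow
import Summits.QuantumFields.YangMills.Theses.ConvexGribovBody
import Summits.QuantumFields.YangMills.Theorems.HypercubicLimit.Negative.AllTimesGapFalse
import Summits.QuantumFields.YangMills.Theorems.ClusteringToYangMills.Negative.DisproofBurden

/-!
# Line `dock-continuum-leg` — skeleton for crux `ClusteringToYangMills` (stmt-QuantumFields-9443)

Route `FradkinShenkerFlow`, crux 4 = `ClusteringHyp → YangMills` (read-back `crux_unfold`, `Iff.rfl`), where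
`ClusteringHyp` is volume-uniform exponential clustering in Euclidean time on the symmetric tori `(ℤ/(2S+1))⁴`,
`n ≤ S`, at every `β ≥ β₀(G,r)`, with a PER-β rate and PER-β, PER-PAIR, UNSTRUCTURED constants `C(A,B,β)`.

## The line (idea card `Ideas/dock-continuum-leg.md`, sharpened by TRIAGE-r1-1/2/3 and Disproof.lean §3)

DOCK, DON'T REBUILD — the STRUCTURAL (fixed-β) entrance.  The crux is the canonical UV hub
`CriticalContinuumLimit` (stmt-8762, stub 3, by name) plus its criticality hypothesis (stub 2, fed by EITHER
existing supplier chain: `XiDiverges` 8941 + `CriticalityOfXiDiverges` 12318, or `FreeEnergyLogCoefficient` 8759 +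
`EquipartitionPinsProbe` 8760 + `RPProbeCriticality` 8763 — both feeders PROVED below) plus ONE adapter turning
`ClusteringHyp` at `(G, r)` into hypothesis (1) of 8762 (`UniformTorusGap`: β-FREE per-pair constants, a rate
function, a threshold function).  The disprover showed (Disproof §3a–c) that the adapter is exactly
`H ⇒ UniformTorusGap`, that it is NOT soft over real `β` (abstract Baire counterexample), and that it is
equivalent to "structured constants per β".  The parallel line `Lines/antipodal-docking.lean` cuts the adapter by
β-REGULARITY (local uniformity on unit coupling intervals + Banach–Steinhaus + a diagonal lemma).

THIS line cuts it the other way, along the card's own anatomy S3b–S3d (OS self-normalisation in the torus-limit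
states + a fixed-β torus thermal window), whose OUTPUT at each single `β` is an EXPLICIT structure theorem:

* `stub_structuredTorusClustering` (the line's own content): at each compact simple `(G, r)`, `ClusteringHyp`
  there implies that at every `β ≥ β₀'` SEPARATELY there are SOME rate `μ_β > 0`, SOME `Γ_β ≥ 0` and a torus
  threshold `S₀(β)` with
  `|corr_{β,2S+1}(A,B;n)| ≤ C_A · C_B · exp(Γ_β · (R(A) + R(B) + 2)) · exp(−μ_β n)`  for all `S ≥ S₀(β)`, `n ≤ S`,
  all sup-bounds `C_A, C_B` of `A, B`, where `R(A) = max_{e ∈ supp A} |e₀|` is the TIME EXTENT of the support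
  (triage r1-1 sharpening: the thermal term sees the time extent `c` of the supports, `ζ_{S+1−c}`; NOT `|supp|`).
  Nothing is uniform or regular in `β`: the β-dependence sits in two numbers `(μ_β, Γ_β)` and the
  (A,B)-dependence is β-free (sup norms × time extents) — which is precisely what rate sacrifice consumes.
  Intended proof (card S3b–d, triage r1-3: ANY rate, not the sharp one): (i) in every torus-limit state at `β`,
  RP + transfer matrix + `H` passed to the limit give the gap `m⋆ ≥ m_β` and the self-normalised bound
  `C_A C_B e^{Γ(R_A+R_B+2)} e^{−μ n}` with `μ := min(m⋆, 1)`, `Γ := 1` (capping the rate removes every upper bound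
  on gaps; `e^{Γ} ≥ 2` pays the a-priori patch for `n ≤ R_A + R_B + 1` and the reflection offset);
  (ii) fixed-β thermal window on the symmetric torus: bounded thermal multiplicity at an aspect `θ < 1/2`
  plus a volume-uniform lower bound on the spatial-torus gap for `N ≥ N₀(β)` (the open core: finite-size theory
  of ONE lattice theory at ONE coupling; true at `β = 0` — `structured_zero_coupling` below — and in the
  strong-coupling expansion regime).
* `stub_admissibleRatesVanish` = hypothesis (2) of 8762 for all `(G, r)` (verbatim shape): every admissible
  volume-uniform clustering rate function tends to `0`.  `admissibleRatesVanish_of_xi` (8941 + 12318) and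
  `admissibleRatesVanish_of_equipartition` (8759 + 8760 + 8763) prove it from existing items.
* `stub_criticalContinuumLimit` = stmt-8762 by name (shared hub; E1, non-Gaussianity, gap transfer).
* PROVED: `uniformTorusGap_of_structuredClusteringAt` (rate sacrifice with `κ(A) := R(A)+1`, threshold kept) and
  the composition `ClusteringToYangMills_of` (three stubs ⊢ the crux, by name); the canonical-adapter form
  `of_adapter`; the dominance `of_continuumLegGivenGap` (card S1: stmt-8782 ⊢ crux by `S₁ := 0`); the unit test
  `structured_zero_coupling` (the explicit shape HOLDS at `β = 0` with `μ = 1`, `Γ = 2`, `S₀ = 0`); and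
  `not_structuredClusteringAt_allTimes` (dropping `n ≤ S` makes the stub's conclusion FALSE — landed
  `Negative/DisproofBurden.not_clusteringAllTimes_at`).

Disproof.lean (cdisprove gen 2, RESISTS; no `_false_without_`, `-- Targets` empty) honoured: `ecPerVolume_trivial`
(every statement keeps `∃ … ∀ S`), `not_ecAllTimes` (every statement keeps `n ≤ S`; checked below),
`structuredH_iff_uniformTorusGap` (our stub is a genuine STRENGTHENING of the adapter: explicit `κ = R + 1`,
`w = C_A C_B`, not `∃ κ w`), `abstract_adapter_false` (we do not claim softness: the stub is a fixed-β structure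
theorem, its β-regularity is the explicit shape), `ec_zero_coupling` (re-proved in the explicit shape),
`yangMillsWithoutNontriviality` (the interacting limit is imported as 8762 + criticality, nothing else consumes H).
-/

noncomputable section

namespace Summit.QuantumFields.YangMills.Cruxes.ClusteringToYangMills.DockContinuumLeg

open MeasureTheory Filter
open Literature.MathematicalPhysics.QuantumFieldTheory
open Summit.QuantumFields.YangMills.Theses
open Summit.QuantumFields.YangMills.Theorems.HypercubicLimit.Negative (abs_latticeConnectedCorr_le)
open Summit.QuantumFields.YangMills.Theorems.LatticeGapOnTrajectory.Negative
  (latticeConnectedCorr_zero_coupling disjoint_torusSupports_of_time_bound)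
open Summit.QuantumFields.YangMills.Theorems.ClusteringToYangMills.Negative (not_clusteringAllTimes_at)

/-! ## §0 Vocabulary (bodies over existing declarations only) -/

/-- The antecedent of the crux, verbatim (= Disproof's `LatticeClustering`, antipodal line's `ClusteringHyp`).
[folklore] -/
def ClusteringHyp : Prop :=
  ∀ (G : Type) [Group G] [TopologicalSpace G] [IsTopologicalGroup G] [CompactSpace G]
    [MeasurableSpace G] [BorelSpace G], IsCompactSimpleLieGroup G →
    ∀ (r : LatticeRep G), ∃ β₀ : ℝ, ∀ β : ℝ, β₀ ≤ β →
      (∃ m : ℝ, 0 < m ∧ ∀ A B : YMSpecies G, ∃ C : ℝ, ∀ S n : ℕ, n ≤ S →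
        |latticeConnectedCorr r.ρ β (2 * S + 1) A.F B.F n| ≤ C * Real.exp (-(m * n)))

/-- Read-back: the crux IS `ClusteringHyp → YangMills`. [folklore] -/
theorem crux_unfold : FradkinShenkerFlow.ClusteringToYangMills ↔ (ClusteringHyp → YangMills) :=
  Iff.rfl

variable {G : Type} [Group G] [TopologicalSpace G] [IsTopologicalGroup G] [CompactSpace G]
  [MeasurableSpace G] [BorelSpace G]

variable (G) in
/-- `ClusteringHyp` at one `(G, r)` (= Disproof's `TorusClusteringH`). [folklore] -/
def ClusteringAt (r : LatticeRep G) : Prop :=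
  ∃ β₀ : ℝ, ∀ β : ℝ, β₀ ≤ β →
    (∃ m : ℝ, 0 < m ∧ ∀ A B : YMSpecies G, ∃ C : ℝ, ∀ S n : ℕ, n ≤ S →
      |latticeConnectedCorr r.ρ β (2 * S + 1) A.F B.F n| ≤ C * Real.exp (-(m * n)))

variable (G) in
/-- Hypothesis (1) of `CriticalContinuumLimit` (stmt-8762) at one `(G, r)` (= body of `LatticeGapLargeBeta`,
stmt-8761; = Disproof's `UniformTorusGap`): β-FREE per-pair constants, a rate function, a threshold function.
[folklore] -/
def UniformTorusGap (r : LatticeRep G) : Prop :=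
  ∃ (β₁ : ℝ) (m : ℝ → ℝ) (S₀ : ℝ → ℕ), (∀ β : ℝ, β₁ ≤ β → 0 < m β) ∧
    ∀ A B : YMSpecies G, ∃ C : ℝ, ∀ β : ℝ, β₁ ≤ β → ∀ S n : ℕ, S₀ β ≤ S → n ≤ S →
      |latticeConnectedCorr r.ρ β (2 * S + 1) A.F B.F n| ≤ C * Real.exp (-(m β * n))

variable (G) in
/-- **Explicitly structured torus clustering at `(G, r)`** (the line's fixed-β structure theorem): above some
`β₀`, at EACH `β` separately, SOME rate `μ > 0`, SOME `Γ ≥ 0` and a torus threshold `S₀` give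
`|corr_{β,2S+1}(A,B;n)| ≤ C_A C_B · exp (Γ (R(A) + R(B) + 2)) · exp (−μ n)` for `S ≥ S₀`, `n ≤ S`, every pair of
local gauge-invariant observables and all sup-bounds `C_A, C_B`, where `R(A) = max_{e ∈ supp A} |e₀|` is the
time extent of the support.  (β enters through `(μ, Γ, S₀)` only; the pair enters β-freely.) [folklore] -/
def StructuredClusteringAt (r : LatticeRep G) : Prop :=
  ∃ β₀ : ℝ, ∀ β : ℝ, β₀ ≤ β → ∃ μ Γ : ℝ, 0 < μ ∧ 0 ≤ Γ ∧ ∃ S₀ : ℕ,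
    ∀ (A B : YMSpecies G) (CA CB : ℝ), (∀ U, |A.F U| ≤ CA) → (∀ U, |B.F U| ≤ CB) →
      ∀ S n : ℕ, S₀ ≤ S → n ≤ S →
        |latticeConnectedCorr r.ρ β (2 * S + 1) A.F B.F n| ≤
          CA * CB * Real.exp (Γ * (((A.supp.sup fun e => (e.1 0).natAbs : ℕ) : ℝ) +
            ((B.supp.sup fun e => (e.1 0).natAbs : ℕ) : ℝ) + 2)) * Real.exp (-(μ * n))

/-- **Stub statement 1 (the line's own content): fixed-β structuring of the clustering constants.**
For every compact simple lattice gauge theory `(G, r)`: volume-uniform clustering with unstructured constants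
(`ClusteringAt`) implies, β by β, clustering with constants `C_A C_B e^{Γ_β (R_A + R_B + 2)}` at some rate
`μ_β` on tori `S ≥ S₀(β)`. [folklore] -/
def StructuredTorusClustering : Prop :=
  ∀ (G : Type) [Group G] [TopologicalSpace G] [IsTopologicalGroup G] [CompactSpace G]
    [MeasurableSpace G] [BorelSpace G], IsCompactSimpleLieGroup G →
    ∀ r : LatticeRep G, ClusteringAt G r → StructuredClusteringAt G r

/-- **Stub statement 2 = hypothesis (2) of `CriticalContinuumLimit` (stmt-8762), for every compact simple
`(G, r)`** (verbatim shape, Borel structure from the topology as in 8762): every admissible volume-uniform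
clustering rate function (β-dependent constants and thresholds allowed) tends to `0` as `β → ∞`.  It is the
common conclusion of the two existing supplier chains `CriticalityOfXiDiverges ∘ XiDiverges` (12318, 8941) and
`RPProbeCriticality ∘ EquipartitionPinsProbe ∘ FreeEnergyLogCoefficient` (8763, 8760, 8759), see §3. [folklore] -/
def AdmissibleRatesVanish : Prop :=
  ∀ (G : Type) [Group G] [TopologicalSpace G] [IsTopologicalGroup G] [CompactSpace G],
    IsCompactSimpleLieGroup G →
      letI : MeasurableSpace G := borel G
      haveI : BorelSpace G := ⟨rfl⟩
      ∀ r : LatticeRep G, ∀ (β₁ : ℝ) (m : ℝ → ℝ),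
        (∀ β : ℝ, β₁ ≤ β → 0 < m β ∧ (∃ S₀ : ℕ, ∀ A B : YMSpecies G, ∃ C : ℝ, ∀ S n : ℕ,
          S₀ ≤ S → n ≤ S →
            |latticeConnectedCorr r.ρ β (2 * S + 1) A.F B.F n| ≤ C * Real.exp (-(m β * n)))) →
        ∀ m₀ : ℝ, 0 < m₀ → ∀ᶠ β : ℝ in Filter.atTop, m β < m₀

/-! ## §1 Registered stubs -/

/-- **stub 1 (new, the line's own content; hardest own stub): fixed-β explicit structuring of the torus
clustering constants** — OS self-normalisation in the torus-limit states + a fixed-β thermal window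
(bounded thermal multiplicity at aspect `θ < 1/2` + volume-uniform spatial-torus gap), ANY rate. [folklore] -/
theorem stub_structuredTorusClustering : StructuredTorusClustering := by
  sorry

/-- **stub 2 (criticality of every admissible rate; = conclusion of stmt-12318 ∘ stmt-8941, or of
stmt-8763 ∘ stmt-8760 ∘ stmt-8759 — existing items, see `admissibleRatesVanish_of_xi` /
`admissibleRatesVanish_of_equipartition`).** [folklore] -/
theorem stub_admissibleRatesVanish : AdmissibleRatesVanish := by
  sorry

/-- **stub 3 = stmt-QuantumFields-8762** `CriticalContinuumLimit` (shared UV hub of EquipartitionCriticality /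
DirichletWindow): gap in `UniformTorusGap` form + criticality ⇒ the interacting OS continuum limit with mass gap.
Open problem (E1, non-Gaussianity of `tr F²`, gap transfer at the spectral rate); staffed once, there.
[folklore] -/
theorem stub_criticalContinuumLimit : EquipartitionCriticality.CriticalContinuumLimit := by
  sorry

/-! ## §2 Proved glue: rate sacrifice, the adapter from the structure theorem, the composition -/

/-- **Rate sacrifice** (elementary; statement and proof from crux-triage r1-3's
`TriageAdapterBookkeeping3.rate_sacrifice`, reproduced so that this file is self-contained): an a-priori bound
`|c| ≤ a` and a clustering bound with multiplicative excess `exp (Γ K)` combine into the `Γ`-FREE constant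
`a · w · exp K` at the slower rate `μ / max 1 Γ`. [folklore] -/
theorem rate_sacrifice {a w K Γ μ x c : ℝ} (ha : 1 ≤ a) (hw : 1 ≤ w) (hK : 0 ≤ K)
    (h1 : |c| ≤ a) (h2 : |c| ≤ w * Real.exp (Γ * K) * Real.exp (-(μ * x))) :
    |c| ≤ a * w * Real.exp K * Real.exp (-(μ / max 1 Γ * x)) := by
  set L := max 1 Γ with hL
  have hL1 : 1 ≤ L := le_max_left _ _
  have hLΓ : Γ ≤ L := le_max_right _ _
  have hL0 : 0 < L := lt_of_lt_of_le one_pos hL1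
  have ha0 : 0 ≤ a := le_trans zero_le_one ha
  have haw : 1 ≤ a * w := by nlinarith
  by_cases h : μ * x ≤ L * K
  · have hle : μ / L * x ≤ K := by
      rw [div_mul_eq_mul_div, div_le_iff₀ hL0]; linarith [mul_comm L K]
    have hone : 1 ≤ Real.exp K * Real.exp (-(μ / L * x)) := by
      rw [← Real.exp_add]; exact Real.one_le_exp (by linarith)
    calc |c| ≤ a := h1
      _ ≤ a * w := by nlinarith
      _ = a * w * 1 := (mul_one _).symm
      _ ≤ a * w * (Real.exp K * Real.exp (-(μ / L * x))) := by
          exact mul_le_mul_of_nonneg_left hone (by linarith)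
      _ = a * w * Real.exp K * Real.exp (-(μ / L * x)) := by ring
  · push Not at h
    have h3 : K < μ * x / L := by rw [lt_div_iff₀ hL0]; linarith
    have h4 : K * (L - 1) ≤ μ * x / L * (L - 1) :=
      mul_le_mul_of_nonneg_right h3.le (by linarith)
    have h5 : K * Γ ≤ K * L := mul_le_mul_of_nonneg_left hLΓ hK
    have h7 : μ * x / L * (L - 1) = μ * x - μ * x / L := by
      field_simp
    have h6 : μ / L * x = μ * x / L := by ring
    have key : Γ * K + -(μ * x) ≤ K + -(μ / L * x) := by
      rw [h6]; rw [h7] at h4; nlinarith [h4, h5]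
    calc |c| ≤ w * Real.exp (Γ * K) * Real.exp (-(μ * x)) := h2
      _ = w * Real.exp (Γ * K + -(μ * x)) := by rw [Real.exp_add]; ring
      _ ≤ w * Real.exp (K + -(μ / L * x)) :=
          mul_le_mul_of_nonneg_left (Real.exp_le_exp.2 key) (by linarith)
      _ = 1 * w * (Real.exp K * Real.exp (-(μ / L * x))) := by rw [Real.exp_add]; ring
      _ ≤ a * w * (Real.exp K * Real.exp (-(μ / L * x))) := by
          apply mul_le_mul_of_nonneg_right _ (by positivity)
          exact mul_le_mul_of_nonneg_right ha (by linarith)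
      _ = a * w * Real.exp K * Real.exp (-(μ / L * x)) := by ring

/-- **The adapter from the structure theorem (rate sacrifice, threshold kept).**  Explicitly structured
clustering at `(G, r)` ⇒ the β-uniform `UniformTorusGap` shape: rate `m(β) := μ_β / max 1 Γ_β`, threshold
`S₀(β)`, and the β-FREE pair constant `max 1 (2 C_A C_B) · max 1 (C_A C_B) · exp (R(A) + R(B) + 2)` with
`C_A, C_B` the bounds chosen from `A.bounded`, `B.bounded`.  No β-regularity is needed: the β-dependence of the
structured bound is confined to `(μ_β, Γ_β, S₀(β))`. [folklore] -/
theorem uniformTorusGap_of_structuredClusteringAt (r : LatticeRep G) (h : StructuredClusteringAt G r) :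
    UniformTorusGap G r := by
  obtain ⟨β₀, hβ⟩ := h
  choose μ Γ hμ hΓ S₀ hb using hβ
  refine ⟨β₀, fun β => if h : β₀ ≤ β then μ β h / max 1 (Γ β h) else 1,
    fun β => if h : β₀ ≤ β then S₀ β h else 0, ?_, ?_⟩
  · intro β hβ0
    simp only [hβ0, ↓reduceDIte]
    exact div_pos (hμ β hβ0) (lt_of_lt_of_le one_pos (le_max_left _ _))
  · intro A B
    obtain ⟨CA, hCA⟩ := A.bounded
    obtain ⟨CB, hCB⟩ := B.bounded
    set K : ℝ := ((A.supp.sup fun e => (e.1 0).natAbs : ℕ) : ℝ) +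
      ((B.supp.sup fun e => (e.1 0).natAbs : ℕ) : ℝ) + 2 with hK
    have hK0 : 0 ≤ K := by positivity
    refine ⟨max 1 (2 * (CA * CB)) * max 1 (CA * CB) * Real.exp K, fun β hβ0 S n hS hn => ?_⟩
    have hS' : S₀ β hβ0 ≤ S := by simpa only [hβ0, ↓reduceDIte] using hS
    have h1 : |latticeConnectedCorr r.ρ β (2 * S + 1) A.F B.F n| ≤ max 1 (2 * (CA * CB)) :=
      (abs_latticeConnectedCorr_le r β (2 * S + 1) hCA hCB n).trans (le_max_right _ _)
    have h2 := hb β hβ0 A B CA CB hCA hCB S n hS' hn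
    have h2' : |latticeConnectedCorr r.ρ β (2 * S + 1) A.F B.F n| ≤
        max 1 (CA * CB) * Real.exp (Γ β hβ0 * K) * Real.exp (-(μ β hβ0 * n)) := by
      refine h2.trans ?_
      have hle : CA * CB ≤ max 1 (CA * CB) := le_max_right _ _
      have := mul_le_mul_of_nonneg_right
        (mul_le_mul_of_nonneg_right hle (Real.exp_pos (Γ β hβ0 * K)).le) (Real.exp_pos (-(μ β hβ0 * n))).le
      simpa only [hK] using this
    have := rate_sacrifice (le_max_left _ _) (le_max_left _ _) hK0 h1 h2'
    simpa only [hβ0, ↓reduceDIte] using this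

/-- **`ClusteringToYangMills_of` — the kernel-checked composition of the line.**  Stubs 1–3 ⊢ the crux BY NAME:
`ClusteringHyp` at each `(G, r)` (Borel structure) is structured β by β (stub 1) and rate-sacrificed into
hypothesis (1) of `CriticalContinuumLimit` (`uniformTorusGap_of_structuredClusteringAt`, proved); hypothesis (2)
is stub 2; stub 3 concludes. [folklore] -/
theorem ClusteringToYangMills_of :
    StructuredTorusClustering → AdmissibleRatesVanish → EquipartitionCriticality.CriticalContinuumLimit →
      FradkinShenkerFlow.ClusteringToYangMills := by
  intro hStr hCrit hCCL hH G _ _ _ _ hG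
  letI : MeasurableSpace G := borel G
  haveI : BorelSpace G := ⟨rfl⟩
  refine hCCL G hG (fun r => ?_) (fun r => hCrit G hG r)
  exact uniformTorusGap_of_structuredClusteringAt r (hStr G hG r (hH G hG r))

/-- The canonical (uncut) adapter of the merged dock line, for reference: per `(G, r)`, H ⇒ `UniformTorusGap`
(= Disproof's `TorusGapUniformisation` ≡ the cards' `UniformiseConstants`). [folklore] -/
def Adapter : Prop :=
  ∀ (G : Type) [Group G] [TopologicalSpace G] [IsTopologicalGroup G] [CompactSpace G]
    [MeasurableSpace G] [BorelSpace G], IsCompactSimpleLieGroup G →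
    ∀ r : LatticeRep G, ClusteringAt G r → UniformTorusGap G r

omit [Group G] [TopologicalSpace G] [IsTopologicalGroup G] [CompactSpace G] [MeasurableSpace G]
  [BorelSpace G] in
/-- Stub 1 is an ENTRANCE to the canonical adapter (this line's bet); the antipodal line's β-regularity +
Banach–Steinhaus pair is the other. [folklore] -/
theorem adapter_of_structuredTorusClustering (h : StructuredTorusClustering) : Adapter :=
  fun G _ _ _ _ _ _ hG r hH => uniformTorusGap_of_structuredClusteringAt r (h G hG r hH)

omit [Group G] [TopologicalSpace G] [IsTopologicalGroup G] [CompactSpace G] [MeasurableSpace G]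
  [BorelSpace G] in
/-- The merged dock line in canonical form: adapter + criticality + 8762 ⊢ crux (so any proof of the adapter,
by either entrance, closes the crux with stubs 2–3). [folklore] -/
theorem of_adapter (hU : Adapter) (hCrit : AdmissibleRatesVanish)
    (hCCL : EquipartitionCriticality.CriticalContinuumLimit) : FradkinShenkerFlow.ClusteringToYangMills := by
  intro hH G _ _ _ _ hG
  letI : MeasurableSpace G := borel G
  haveI : BorelSpace G := ⟨rfl⟩
  exact hCCL G hG (fun r => hU G hG r (hH G hG r)) (fun r => hCrit G hG r)

/-! ## §3 Proved feeders of stub 2 from existing items (both supplier chains) -/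

omit [Group G] [TopologicalSpace G] [IsTopologicalGroup G] [CompactSpace G] [MeasurableSpace G]
  [BorelSpace G] in
/-- Supplier chain A: `XiDiverges` (stmt-8941) + `CriticalityOfXiDiverges` (stmt-12318) ⊢ stub 2. [folklore] -/
theorem admissibleRatesVanish_of_xi (hXi : DirichletWindow.XiDiverges)
    (h : DirichletWindow.CriticalityOfXiDiverges) : AdmissibleRatesVanish :=
  fun G _ _ _ _ hG => h hXi G hG

omit [Group G] [TopologicalSpace G] [IsTopologicalGroup G] [CompactSpace G] [MeasurableSpace G]
  [BorelSpace G] in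
/-- Supplier chain B (the card's S2 dock): `FreeEnergyLogCoefficient` (stmt-8759) + `EquipartitionPinsProbe`
(stmt-8760) + `RPProbeCriticality` (stmt-8763) ⊢ stub 2. [folklore] -/
theorem admissibleRatesVanish_of_equipartition (h59 : EquipartitionCriticality.FreeEnergyLogCoefficient)
    (h60 : EquipartitionCriticality.EquipartitionPinsProbe)
    (h63 : EquipartitionCriticality.RPProbeCriticality) : AdmissibleRatesVanish :=
  fun G _ _ _ _ hG r => h63 G hG r (h60 G hG r (h59 G hG r))

/-! ## §4 Dominance (card S1): the shared existence leg stmt-8782 alone implies the crux -/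

omit [Group G] [TopologicalSpace G] [IsTopologicalGroup G] [CompactSpace G] [MeasurableSpace G]
  [BorelSpace G] in
/-- `ContinuumLegGivenGap` (stmt-QuantumFields-8782, routes ConvexGribovBody / SmallCircleAnchor) ⊢ crux, by
`S₁ := 0` (the crux's hypothesis clusters on ALL tori, 8782's only on `S ≥ S₁(β)`): whoever proves 8782 closes
9443; recorded for staffing, not a stub of this line. [folklore] -/
theorem of_continuumLegGivenGap (h : ConvexGribovBody.ContinuumLegGivenGap) :
    FradkinShenkerFlow.ClusteringToYangMills := by
  intro hEC G _ _ _ _ hG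
  letI : MeasurableSpace G := borel G
  haveI : BorelSpace G := ⟨rfl⟩
  refine h G hG (fun r => ?_)
  obtain ⟨β₀, hβ₀⟩ := hEC G hG r
  refine ⟨β₀, fun β hβ => ?_⟩
  obtain ⟨m, hm, hAB⟩ := hβ₀ β hβ
  exact ⟨m, hm, 0, fun A B => (hAB A B).imp fun C hC S n _ hn => hC S n hn⟩

/-! ## §5 Consistency checks against the disprover's findings -/

/-- **Unit test at `β = 0` (cf. Disproof `ec_zero_coupling`, landed `clustering_zero_coupling`): the EXPLICIT
structured shape of stub 1 holds at zero coupling** with `μ = 1`, `Γ = 2`, `S₀ = 0`: independent Haar links make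
the connected correlation vanish once the torus projections of the supports are disjoint (`2R < n`,
`n + 2R < 2S+1`, `R = max (R(A), R(B))`), and in the near regime (`n ≤ 2R`) the a priori bound
`2 C_A C_B ≤ C_A C_B e^{2(R(A)+R(B)+2) − n}` applies. [folklore] -/
theorem structured_zero_coupling (r : LatticeRep G) (A B : YMSpecies G) (CA CB : ℝ)
    (hCA : ∀ U, |A.F U| ≤ CA) (hCB : ∀ U, |B.F U| ≤ CB) (S n : ℕ) (hn : n ≤ S) :
    |latticeConnectedCorr r.ρ 0 (2 * S + 1) A.F B.F n| ≤
      CA * CB * Real.exp (2 * (((A.supp.sup fun e => (e.1 0).natAbs : ℕ) : ℝ) +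
        ((B.supp.sup fun e => (e.1 0).natAbs : ℕ) : ℝ) + 2)) * Real.exp (-(1 * n)) := by
  set RA : ℕ := A.supp.sup fun e => (e.1 0).natAbs with hRA
  set RB : ℕ := B.supp.sup fun e => (e.1 0).natAbs with hRB
  set R : ℕ := max RA RB with hR
  have hA : ∀ e ∈ A.supp, |e.1 0| ≤ R := fun e he => by
    have h1 : (e.1 0).natAbs ≤ RA := Finset.le_sup (f := fun e => (e.1 0).natAbs) he
    have h2 : (e.1 0).natAbs ≤ R := h1.trans (le_max_left _ _)
    rw [Int.abs_eq_natAbs]; exact_mod_cast h2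
  have hB : ∀ e ∈ B.supp, |e.1 0| ≤ R := fun e he => by
    have h1 : (e.1 0).natAbs ≤ RB := Finset.le_sup (f := fun e => (e.1 0).natAbs) he
    have h2 : (e.1 0).natAbs ≤ R := h1.trans (le_max_right _ _)
    rw [Int.abs_eq_natAbs]; exact_mod_cast h2
  have hCAB : 0 ≤ CA * CB := by
    have h0 := abs_latticeConnectedCorr_le r 0 (2 * 0 + 1) hCA hCB 0
    have := abs_nonneg (latticeConnectedCorr r.ρ 0 (2 * 0 + 1) A.F B.F 0)
    linarith
  by_cases hfar : 2 * R < n ∧ n + 2 * R < 2 * S + 1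
  · have hdisj := disjoint_torusSupports_of_time_bound A.supp B.supp R hA hB hfar.1 hfar.2
    rw [latticeConnectedCorr_zero_coupling r.ρ (2 * S + 1) A B n hdisj, abs_zero]
    positivity
  · have hn2 : n ≤ 2 * R := by omega
    have hRle : R ≤ RA + RB := max_le (Nat.le_add_right _ _) (Nat.le_add_left _ _)
    have hnR : (n : ℝ) ≤ 2 * ((RA : ℝ) + RB) := by
      have : n ≤ 2 * (RA + RB) := hn2.trans (by omega)
      exact_mod_cast this
    have h := abs_latticeConnectedCorr_le r 0 (2 * S + 1) hCA hCB n
    have hexp : 2 ≤ Real.exp (2 * ((RA : ℝ) + RB + 2)) * Real.exp (-(1 * n)) := by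
      rw [← Real.exp_add]
      have h1 : (1 : ℝ) ≤ 2 * ((RA : ℝ) + RB + 2) + -(1 * n) := by linarith
      calc (2 : ℝ) ≤ Real.exp 1 := by have := Real.add_one_le_exp (1 : ℝ); linarith
        _ ≤ Real.exp (2 * ((RA : ℝ) + RB + 2) + -(1 * n)) := Real.exp_le_exp.2 h1
    calc |latticeConnectedCorr r.ρ 0 (2 * S + 1) A.F B.F n| ≤ 2 * (CA * CB) := h
      _ = CA * CB * 2 := by ring
      _ ≤ CA * CB * (Real.exp (2 * ((RA : ℝ) + RB + 2)) * Real.exp (-(1 * n))) :=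
          mul_le_mul_of_nonneg_left hexp hCAB
      _ = CA * CB * Real.exp (2 * ((RA : ℝ) + RB + 2)) * Real.exp (-(1 * n)) := by ring

/-- Packaged: the conclusion of `StructuredClusteringAt` at the single coupling `β = 0`, for EVERY compact `G`
and every `r` (so the explicit shape is consistent with the one regime where everything is computable).
[folklore] -/
theorem structuredShape_zero_coupling (r : LatticeRep G) :
    ∃ μ Γ : ℝ, 0 < μ ∧ 0 ≤ Γ ∧ ∃ S₀ : ℕ,
      ∀ (A B : YMSpecies G) (CA CB : ℝ), (∀ U, |A.F U| ≤ CA) → (∀ U, |B.F U| ≤ CB) →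
        ∀ S n : ℕ, S₀ ≤ S → n ≤ S →
          |latticeConnectedCorr r.ρ 0 (2 * S + 1) A.F B.F n| ≤
            CA * CB * Real.exp (Γ * (((A.supp.sup fun e => (e.1 0).natAbs : ℕ) : ℝ) +
              ((B.supp.sup fun e => (e.1 0).natAbs : ℕ) : ℝ) + 2)) * Real.exp (-(μ * n)) :=
  ⟨1, 2, one_pos, by norm_num, 0, fun A B CA CB hCA hCB S n _ hn =>
    structured_zero_coupling r A B CA CB hCA hCB S n hn⟩

/-- Stub 1's conclusion implies `ClusteringAt` on its tail (threshold volumes by the a priori bound): the stub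
is a genuine UPGRADE of the crux's hypothesis at `(G, r)`, sandwiched between it and nothing weaker.
[folklore] -/
theorem clusteringAt_of_structuredClusteringAt (r : LatticeRep G) (h : StructuredClusteringAt G r) :
    ClusteringAt G r := by
  obtain ⟨β₀, hβ⟩ := h
  refine ⟨β₀, fun β hβ0 => ?_⟩
  obtain ⟨μ, Γ, hμ, hΓ, S₀, hb⟩ := hβ β hβ0
  refine ⟨μ, hμ, fun A B => ?_⟩
  obtain ⟨CA, hCA⟩ := A.bounded
  obtain ⟨CB, hCB⟩ := B.bounded
  set K : ℝ := ((A.supp.sup fun e => (e.1 0).natAbs : ℕ) : ℝ) +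
    ((B.supp.sup fun e => (e.1 0).natAbs : ℕ) : ℝ) + 2 with hK
  have hCAB : 0 ≤ CA * CB := by
    have h0 := abs_latticeConnectedCorr_le r β (2 * 0 + 1) hCA hCB 0
    have := abs_nonneg (latticeConnectedCorr r.ρ β (2 * 0 + 1) A.F B.F 0)
    linarith
  refine ⟨max (CA * CB * Real.exp (Γ * K)) (2 * (CA * CB) * Real.exp (μ * S₀)), fun S n hn => ?_⟩
  by_cases hS : S₀ ≤ S
  · calc |latticeConnectedCorr r.ρ β (2 * S + 1) A.F B.F n|
        ≤ CA * CB * Real.exp (Γ * K) * Real.exp (-(μ * n)) := by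
          simpa only [hK] using hb A B CA CB hCA hCB S n hS hn
      _ ≤ max (CA * CB * Real.exp (Γ * K)) (2 * (CA * CB) * Real.exp (μ * S₀)) * Real.exp (-(μ * n)) :=
          mul_le_mul_of_nonneg_right (le_max_left _ _) (Real.exp_pos _).le
  · push Not at hS
    have hnS : (n : ℝ) ≤ S₀ := by exact_mod_cast (hn.trans hS.le)
    have hexp : 1 ≤ Real.exp (μ * S₀) * Real.exp (-(μ * n)) := by
      rw [← Real.exp_add]; refine Real.one_le_exp ?_
      nlinarith [hμ.le, hnS]
    calc |latticeConnectedCorr r.ρ β (2 * S + 1) A.F B.F n| ≤ 2 * (CA * CB) * 1 := by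
          rw [mul_one]; exact abs_latticeConnectedCorr_le r β (2 * S + 1) hCA hCB n
      _ ≤ 2 * (CA * CB) * (Real.exp (μ * S₀) * Real.exp (-(μ * n))) :=
          mul_le_mul_of_nonneg_left hexp (by positivity)
      _ = 2 * (CA * CB) * Real.exp (μ * S₀) * Real.exp (-(μ * n)) := by ring
      _ ≤ max (CA * CB * Real.exp (Γ * K)) (2 * (CA * CB) * Real.exp (μ * S₀)) * Real.exp (-(μ * n)) :=
          mul_le_mul_of_nonneg_right (le_max_right _ _) (Real.exp_pos _).le

/-- **The ALL-TIMES strengthening of stub 1's conclusion (restriction `n ≤ S` dropped) is FALSE** for every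
non-abelian compact `G` and every `r`: at `S = S₀`, `A = B =` curvature it would give an all-times exponential
bound, refuted by the landed `Negative/DisproofBurden.not_clusteringAllTimes_at`.  The line keeps `n ≤ S` in
every statement. [folklore] -/
theorem not_structuredClusteringAt_allTimes (hG : ∃ a b : G, a * b ≠ b * a) (r : LatticeRep G) :
    ¬ (∃ β₀ : ℝ, ∀ β : ℝ, β₀ ≤ β → ∃ μ Γ : ℝ, 0 < μ ∧ 0 ≤ Γ ∧ ∃ S₀ : ℕ,
        ∀ (A B : YMSpecies G) (CA CB : ℝ), (∀ U, |A.F U| ≤ CA) → (∀ U, |B.F U| ≤ CB) →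
          ∀ S n : ℕ, S₀ ≤ S →
            |latticeConnectedCorr r.ρ β (2 * S + 1) A.F B.F n| ≤
              CA * CB * Real.exp (Γ * (((A.supp.sup fun e => (e.1 0).natAbs : ℕ) : ℝ) +
                ((B.supp.sup fun e => (e.1 0).natAbs : ℕ) : ℝ) + 2)) * Real.exp (-(μ * n))) := by
  rintro ⟨β₀, hβ⟩
  obtain ⟨μ, Γ, hμ, -, S₀, hb⟩ := hβ β₀ le_rfl
  obtain ⟨CP, hCP⟩ := r.curvature.bounded
  refine not_clusteringAllTimes_at hG r β₀ hμ S₀ ⟨CP * CP * Real.exp (Γ *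
    (((r.curvature.supp.sup fun e => (e.1 0).natAbs : ℕ) : ℝ) +
      ((r.curvature.supp.sup fun e => (e.1 0).natAbs : ℕ) : ℝ) + 2)), fun n => ?_⟩
  exact hb r.curvature r.curvature CP CP hCP hCP S₀ n le_rfl

end Summit.QuantumFields.YangMills.Cruxes.ClusteringToYangMills.DockContinuumLeg

end
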